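import Summits.QuantumFields.YangMills.Theorems.BalabanUVNodesN18HLayerW1TermAnalytic
import Literature.MathematicalPhysics.QuantumFieldTheory.Balaban1983to89.Node00.HistoryTermDatum214Inputs226

/-!
# BalabanUVNodes ∕ N18 — (T-an) ∧ (T-226) AT node00-def-W1's (2.14) TERM DATUM IN THE CONFIGURATION DIRECTION, KEYED ON W1's RECORD OF LOCATED INPUTS
# `TermDatum214.Inputs226Holo` (Track A, DAG node N18 = NE5 `T4OutputRate.NE5 EA EB W κ θ C₅` :211; cluster K4 «SpineRates»; file 30 of seat
# pub-ymgap-dag-n18-c, row s1 «the H-layer activity datum on the record's torus catalogue: instance + estimate», generation 10)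

Cell `pub-ymgap`, HUMAN RULING D-0062 (Track A), R134 ACCELERATION seat `pub-ymgap-dag-n18-c` (strategy s1), generation 10.  THEOREMS ONLY (no `def`, no
`instance`, no `sorry`); imports file 26 `…N18HLayerW1TermAnalytic` (through it W1's STOREY 7 `Node00/HistoryTermDatum214`, the cell `pub-balaban-gaps` engine
`Spine/NE5/TwoRunTorusPrimitiveParam` and [Chae1985] `Literature/Analysis/Complex/HolomorphicBanach`) and W1's STOREY 8 `Node00/HistoryTermDatum214Inputs226`
(the record `TermDatum214.Inputs226Holo`, its shadow `PrimitiveInputs226Holo`, the socket `Inputs226Holo.norm_TF_le_weight`) BY NAME; restates nothing.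

WHY.  W1's STOREY 8 bundles the fifty located (2.26) inputs of ONE term `(Z, t)` of the datum at `(s, old, φ)` as ONE record
`ι : 𝔇.Inputs226Holo c Z t s old φ a a₅` — by its own word the currency the Summit-side per-term schemas of N22 ((S-226-T)), N10 and N18 ((T-226)) are to
read instead of restating the list; node N10's `B13TermDatum214ParamHolo` (seat n10-c) consumes it along a holomorphically parametrised HISTORY (ONE record +
the two history-dependent fields `hVm`, `h220U` transported along the parameter).  File 26 of this seat — (T-an) ∧ (T-226) in the CONFIGURATION `φ = (𝐔, 𝐉)`,
[II] p. 15 «analytic function of (𝐔, 𝐉) … by inspection of (2.14)» — was typed off STOREY 7 and displays the fifty binders itself.  THIS FILE re-keys it on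
the record, n10-c's way, so that the three nodes read ONE per-term currency: along the configuration ELEVEN fields of the record move (the kernels
`A(σ, uOf φ)`, `G(σ, uOf φ)` are read AT the configuration: `hAhol hGhol hAs hA hG hCs hdΓ hdC hdE`; LEMMA 2's potentials `𝐕_k(Y, s, old, φ, ·)`: `hVm h220U`),
the other thirty-nine (the τ-radii (2.18), the regions `Uσ`, `Uτ`, the contour radius, `χ ∕ χᶜ` at the coupling with (2.22), the references `C`, `Γ₀` with
`hΓ₀ hC216 hΓq hc`, the fibre bound, the rates and every numeral of (2.24)–(2.26) and p. 17) are configuration-free and are read off ONE record at a base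
configuration; the engine's three joint-holomorphy letters `hAholφ hGholφ hVholφ` (IN `φ`, each `σ` of the record's open σ-polydisc ∕ each `(Y, B)`) stay
displayed — they are NODE A's joint `(σ,u)`-analyticity ∘ W1's reading map and LEMMA 2's (1.41) (file 27 reads them off NODE A's walk records).

WHAT (theorems only).
* §1 `primitiveInputs226Holo_of_config` — THE RECORD TRANSPORTS ALONG THE CONFIGURATION: a record at `φ₀` plus the eleven configuration-dependent fields at
  `φ` (stated with the record's letters) give W1's `PrimitiveInputs226Holo` at `φ` (twin of n10-c's `primitiveInputs226Holo_of_potentials`).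
* §2 ONE TERM of `𝔇 : W1.TermDatum214 c₀ P 𝔸 M k L`, estimate record `c` (STOREY 8 §2's convention: the datum's `c₀` only keys its kernel tower), ANY open
  `V ⊆ CPair P 𝔸`: ★★ `differentiableOn_and_norm_TF_of_inputs226Holo_param` (ONE record at a base configuration + the eleven fields UNIFORM on `V` + the three
  joint-holomorphy letters ⟹ `φ ↦ 𝔇.TF Z t s old φ` is `DifferentiableOn ℂ` on `V` AND (2.26) at every `φ ∈ V`; = the engine
  `TwoRunTorusPrimitiveParam.hol_and_h226_torus_of_primitives_param` at `B := CPair P 𝔸`, field by field from the record); the TABLE-BASED edition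
  ★ `differentiableOn_and_norm_TF_of_inputs226Holo_on` (at every point of `V` a record whose eleven moving fields hold on all of `V` — vacuous on an empty
  table, the shape NODE A's uniform records meet trivially) and its two consumer currencies ★ `analyticOnNhd_and_primitiveInputs226Holo_of_inputs226Holo_on`
  (file 23's (T-an) type on `V` by [Chae1985] Thm 14.13 ∧ W1's Prop record at every `φ ∈ V`, whence (2.26) by `norm_TF_le_weight_of_inputs226Holo`).
* §3 A DATUM FAMILY `𝔇 : W1.TermData214 c₀ (F.P K) 𝔸 M L` ALONG THE HISTORY on OPEN located-inputs tables `big (k+1) Z`, under LEMMA 2's guard «old ∈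
  (1.18)`(E₀,r₁)` on `sp` + analytic there»: `holAnd226_TF_of_inputs226Holo`, ★★ `termwiseAn_TF_of_inputs226Holo` — file 23's `hTan` binder type VERBATIM on
  every `sp₁ ⊆ big`, from the table-based records.

HONEST FRAMING — what this is NOT.  Count-neutral by-name knit: one application of a landed generic theorem per term + Chae's theorem + record
bookkeeping; NO estimate of Bałaban's is proved here; the record is a LIST OF HYPOTHESES (inhabited only by supplying every located input — NODE A's
kernel records at the configuration, LEMMA 2 along the history, (2.22), the numerics), the three joint-holomorphy letters are HYPOTHESES, the datum is DATA.
NOT a discharge of N18 (typed 28∕28 · discharged 5∕27 UNCHANGED); NE5 NOT IN PRINT ([I] Thm 1 p. 259) and NOT PROVED; N10 ∕ N22 ∕ NODE A untouched.  One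
finite four-torus programme at fixed `ε`, Bałaban as printed — NOT ℝ⁴, NOT infinite volume, NOT OS, NOT a mass gap, NOT Clay.  0 `sorry`, 0 `def`.

References (TYPES ∕ loci only): [II] = [Balaban1988RG2Cluster] CMP **116** (1988) — Lemma 2 and (1.41) p. 11, (2.14)–(2.15) p. 15 and the analyticity
statement p. 15, (2.16)–(2.22) p. 16, (2.23)–(2.26) p. 17; [I] = [Balaban1987RG1] CMP **109** (1987) — (1.18) p. 263, Thm 1 p. 259; [Chae1985] Thm 14.13.
-/

noncomputable section

open scoped Classical

namespace Summit.QuantumFields.YangMills.BalabanUVNodes.N18HLayerW1TermInputs226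

open Set Metric
open scoped BigOperators Matrix Matrix.Norms.L2Operator
open Literature.MathematicalPhysics.QuantumFieldTheory.Balaban1983to89
open Literature.MathematicalPhysics.QuantumFieldTheory.Balaban1983to89.T4Continuum (T4Family)
open Literature.MathematicalPhysics.QuantumFieldTheory.Balaban1983to89.TreeLengthTorus (TDom TPt tsys)
open Literature.MathematicalPhysics.QuantumFieldTheory.Balaban1983to89.B13Lemma3TorusTerms (terms weight)
open Literature.MathematicalPhysics.QuantumFieldTheory.Balaban1983to89.B13Bound143 (invTau)
open Literature.MathematicalPhysics.QuantumFieldTheory.Balaban1983to89.B9Thm37GlueTorus (tdist1)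
open Literature.MathematicalPhysics.QuantumFieldTheory.Balaban1983to89.B5TorusCover (UT)
open Literature.MathematicalPhysics.QuantumFieldTheory.Balaban1983to89.Node00
open Literature.MathematicalPhysics.QuantumFieldTheory.Balaban1983to89.Node00.Sect2 (domSys domCount CPair)
open Literature.MathematicalPhysics.QuantumFieldTheory.Balaban1983to89.Node00.W1
open Literature.Analysis.Complex.HolomorphicBanach (analyticOnNhd_of_differentiableOn)
open Summit.QuantumFields.BalabanUV.T4Continuum.Spine.NE5.TwoRunTorusPrimitiveParam (hol_and_h226_torus_of_primitives_param)

/-! ## §1 W1's record of located (2.26) inputs transports along the configuration -/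

section OneTerm

variable {c₀ : B13.Consts} {P : Params} {𝔸 : Type} [NormedRing 𝔸] [NormedAlgebra ℂ 𝔸] {M k L : ℕ} [NeZero L]
  (𝔇 : TermDatum214 c₀ P 𝔸 M k L)

omit [NormedRing 𝔸] [NormedAlgebra ℂ 𝔸] in
/-- **THE LOCATED (2.26) INPUTS READ THE CONFIGURATION ONLY THROUGH THE KERNELS AT `u = uOf φ` AND LEMMA 2's POTENTIALS**: a record of located inputs at a
base configuration `φ₀`, together with — at another configuration `φ`, stated with the record's letters `Uσ`, `Uτ`, `a₂₀`, `w`, `κ`, `K_G`, `K_Cs`, `θ_Γ`, `θ_C`,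
`θ_E` — entrywise σ-holomorphy of `A(σ, uOf φ)`, `G(σ, uOf φ)` on the open σ-polydisc, measurability of `𝐕_k(Y, s, old, φ, ·)`, symmetry ∕ `Re ≻ 0` of the
precision, (2.20) on the per-domain τ-region and the five kernel letters (L17a) ∕ (L16a) at `φ`, gives W1's `PrimitiveInputs226Holo` at `φ` (the other
thirty-nine fields are configuration-free). [cite: Balaban1988RG2Cluster, (2.14)-(2.15) p.15, (2.16)-(2.22) p.16, (2.23)-(2.26) p.17, Lemma 2 p.11] -/
theorem primitiveInputs226Holo_of_config {c : B13.Consts} {Z : (domSys P M (k + 1)).Dom} {t : TermLabel P M k L} {s : ℂ} {old : OlderTerms P 𝔸 M k}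
    {φ₀ φ : CPair P 𝔸} {a a₅ : ℝ} (ι : 𝔇.Inputs226Holo c Z t s old φ₀ a a₅)
    (hAhol : ∀ i j, DifferentiableOn ℂ (fun σ => 𝔇.A Z t φ σ i j) {σ | ∀ j, σ j ∈ ι.Uσ})
    (hGhol : ∀ i j, DifferentiableOn ℂ (fun σ => (𝔇.𝒦 Z t).G2 σ (𝔇.uOf Z t φ) i j) {σ | ∀ j, σ j ∈ ι.Uσ})
    (hVm : ∀ Y, Measurable (𝔇.𝒱 Z t s old φ Y))
    (hAs : ∀ σ : TPt P.d (domCount P M (k + 1)) → ℂ, (∀ j, σ j ∈ ι.Uσ) → (𝔇.A Z t φ σ).IsSymm)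
    (hA : ∀ σ : TPt P.d (domCount P M (k + 1)) → ℂ, (∀ j, σ j ∈ ι.Uσ) → ((𝔇.A Z t φ σ).map Complex.re).PosDef)
    (h220U : ∀ τ : TDom P.d (L * domCount P M (k + 1)) → ℂ, (∀ Y, τ Y ∈ ι.Uτ Y) →
      ∀ B, ∑ Y ∈ t.1, ‖τ Y‖ * ‖𝔇.𝒱 Z t s old φ Y B‖ ≤ ι.a₂₀ / 2 * (B ⬝ᵥ B) + ι.w)
    (hG : ∀ σ : TPt P.d (domCount P M (k + 1)) → ℂ, (∀ j, σ j ∈ ι.Uσ) →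
      ∀ b j, ‖(𝔇.𝒦 Z t).G2 σ (𝔇.uOf Z t φ) b j‖ ≤ ι.KG * Real.exp (-(ι.kap * tdist1 𝔇.Nf ((𝔇.𝒦 Z t).locΛ b) ((𝔇.𝒦 Z t).locN j))))
    (hCs : ∀ σ : TPt P.d (domCount P M (k + 1)) → ℂ, (∀ j, σ j ∈ ι.Uσ) →
      ∀ b b', ‖(𝔇.A Z t φ σ)⁻¹ b b'‖ ≤ ι.KCs * Real.exp (-(ι.kap * tdist1 𝔇.Nf ((𝔇.𝒦 Z t).locΛ b) ((𝔇.𝒦 Z t).locΛ b'))))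
    (hdΓ : ∀ σ : TPt P.d (domCount P M (k + 1)) → ℂ, (∀ j, σ j ∈ ι.Uσ) →
      ∀ b j, ‖((𝔇.𝒦 Z t).G2 σ (𝔇.uOf Z t φ) - (𝔇.𝒦 Z t).Γ₀.map (algebraMap ℝ ℂ)) b j‖
        ≤ ι.θΓ * Real.exp (-(ι.kap * tdist1 𝔇.Nf ((𝔇.𝒦 Z t).locΛ b) ((𝔇.𝒦 Z t).locN j))))
    (hdC : ∀ σ : TPt P.d (domCount P M (k + 1)) → ℂ, (∀ j, σ j ∈ ι.Uσ) →
      ∀ b b', ‖((𝔇.A Z t φ σ)⁻¹ - (𝔇.𝒦 Z t).C.map (algebraMap ℝ ℂ)) b b'‖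
        ≤ ι.θC * Real.exp (-(ι.kap * tdist1 𝔇.Nf ((𝔇.𝒦 Z t).locΛ b) ((𝔇.𝒦 Z t).locΛ b'))))
    (hdE : ∀ σ : TPt P.d (domCount P M (k + 1)) → ℂ, (∀ j, σ j ∈ ι.Uσ) →
      ∀ b b', ‖(𝔇.A Z t φ σ - (𝔇.𝒦 Z t).C⁻¹.map (algebraMap ℝ ℂ)) b b'‖
        ≤ ι.θE * Real.exp (-(ι.kap * tdist1 𝔇.Nf ((𝔇.𝒦 Z t).locΛ b) ((𝔇.𝒦 Z t).locΛ b')))) :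
    𝔇.PrimitiveInputs226Holo c Z t s old φ a a₅ :=
  ⟨{ ι with
      hAhol := hAhol, hGhol := hGhol, hVm := hVm, hAs := hAs, hA := hA, h220U := h220U, hG := hG, hCs := hCs, hdΓ := hdΓ, hdC := hdC
      hdE := hdE }⟩

/-! ## §2 One term of a datum: holomorphy in the configuration on an open table + (2.26) there, keyed on ONE record -/

/-- **★★ (T-an) ∧ (T-226) FOR ONE TERM OF THE DATUM ON AN OPEN CONFIGURATION TABLE, KEYED ON ONE RECORD OF LOCATED INPUTS** — file 26's
`differentiableOn_and_norm_TF_of_primitives_param` with its thirty-nine configuration-free binders read off ONE record `ι : 𝔇.Inputs226Holo c Z t s old φ₀ a a₅`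
at a base configuration `φ₀` (any), the eleven configuration-dependent fields asked UNIFORMLY on the open table `V` with the record's letters, and the
engine's three joint-holomorphy letters (`A(σ, uOf φ)`, `G(σ, uOf φ)` holomorphic IN `φ` on `V` at each `σ` of the record's open σ-polydisc; the potentials
`𝐕_k(Y, s, old, φ, B)` holomorphic IN `φ` on `V`).  Conclusion: `φ ↦ 𝔇.TF Z t s old φ` is `DifferentiableOn ℂ` on `V` AND
`‖𝔇.TF Z t s old φ‖ ≤ weight L M c Z a t · e^{a₅|Z|}` at every `φ ∈ V` — ONE application of `TwoRunTorusPrimitiveParam.hol_and_h226_torus_of_primitives_param`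
at the parameter space `B := CPair P 𝔸` (the term IS `term214 r (Z∖Z′₀) 𝐃 (core214 (A φ) (Γ φ) (F214 |P| χ χᶜ 𝐃 (𝐕 φ))) 0 0`, `TF_apply`), field by field
from `ι`; the estimate's record `c` need not be the datum's `c₀`. [cite: Balaban1988RG2Cluster, (2.14)-(2.15) p.15 and the analyticity statement p.15,
(2.16)-(2.22) p.16, (2.23)-(2.26) p.17, Lemma 2 p.11] -/
theorem differentiableOn_and_norm_TF_of_inputs226Holo_param {c : B13.Consts} (hκ₁ : 1 ≤ c.κ₁) (hα₆ : c.α₆ ≠ 0)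
    (Z : (domSys P M (k + 1)).Dom) (t : TermLabel P M k L) (s : ℂ) (old : OlderTerms P 𝔸 M k) {V : Set (CPair P 𝔸)} (hV : IsOpen V)
    {φ₀ : CPair P 𝔸} {a a₅ : ℝ} (ι : 𝔇.Inputs226Holo c Z t s old φ₀ a a₅)
    -- NODE A at the configuration: the kernels entrywise holomorphic IN σ on the record's open σ-polydisc (each φ of the table) and IN φ on the table (each σ)
    (hAhol : ∀ φ ∈ V, ∀ i j, DifferentiableOn ℂ (fun σ => 𝔇.A Z t φ σ i j) {σ | ∀ j, σ j ∈ ι.Uσ})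
    (hGhol : ∀ φ ∈ V, ∀ i j, DifferentiableOn ℂ (fun σ => (𝔇.𝒦 Z t).G2 σ (𝔇.uOf Z t φ) i j) {σ | ∀ j, σ j ∈ ι.Uσ})
    (hAholφ : ∀ σ : TPt P.d (domCount P M (k + 1)) → ℂ, (∀ j, σ j ∈ ι.Uσ) → ∀ i j, DifferentiableOn ℂ (fun φ => 𝔇.A Z t φ σ i j) V)
    (hGholφ : ∀ σ : TPt P.d (domCount P M (k + 1)) → ℂ, (∀ j, σ j ∈ ι.Uσ) →
      ∀ i j, DifferentiableOn ℂ (fun φ => (𝔇.𝒦 Z t).G2 σ (𝔇.uOf Z t φ) i j) V)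
    -- LEMMA 2 at (coupling, history): the potentials holomorphic IN φ on the table, measurable in the row-bond field, (2.20) on the record's τ-region
    (hVholφ : ∀ Y B, DifferentiableOn ℂ (fun φ => 𝔇.𝒱 Z t s old φ Y B) V)
    (hVm : ∀ φ ∈ V, ∀ Y, Measurable (𝔇.𝒱 Z t s old φ Y))
    (hAs : ∀ φ ∈ V, ∀ σ : TPt P.d (domCount P M (k + 1)) → ℂ, (∀ j, σ j ∈ ι.Uσ) → (𝔇.A Z t φ σ).IsSymm)
    (hA : ∀ φ ∈ V, ∀ σ : TPt P.d (domCount P M (k + 1)) → ℂ, (∀ j, σ j ∈ ι.Uσ) → ((𝔇.A Z t φ σ).map Complex.re).PosDef)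
    (h220U : ∀ φ ∈ V, ∀ τ : TDom P.d (L * domCount P M (k + 1)) → ℂ, (∀ Y, τ Y ∈ ι.Uτ Y) →
      ∀ B, ∑ Y ∈ t.1, ‖τ Y‖ * ‖𝔇.𝒱 Z t s old φ Y B‖ ≤ ι.a₂₀ / 2 * (B ⬝ᵥ B) + ι.w)
    -- NODE A at the configuration: (L17a) ∕ (L16a) for the kernels at `u = uOf φ`, with the record's constants and rate, uniform on the table
    (hG : ∀ φ ∈ V, ∀ σ : TPt P.d (domCount P M (k + 1)) → ℂ, (∀ j, σ j ∈ ι.Uσ) →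
      ∀ b j, ‖(𝔇.𝒦 Z t).G2 σ (𝔇.uOf Z t φ) b j‖ ≤ ι.KG * Real.exp (-(ι.kap * tdist1 𝔇.Nf ((𝔇.𝒦 Z t).locΛ b) ((𝔇.𝒦 Z t).locN j))))
    (hCs : ∀ φ ∈ V, ∀ σ : TPt P.d (domCount P M (k + 1)) → ℂ, (∀ j, σ j ∈ ι.Uσ) →
      ∀ b b', ‖(𝔇.A Z t φ σ)⁻¹ b b'‖ ≤ ι.KCs * Real.exp (-(ι.kap * tdist1 𝔇.Nf ((𝔇.𝒦 Z t).locΛ b) ((𝔇.𝒦 Z t).locΛ b'))))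
    (hdΓ : ∀ φ ∈ V, ∀ σ : TPt P.d (domCount P M (k + 1)) → ℂ, (∀ j, σ j ∈ ι.Uσ) →
      ∀ b j, ‖((𝔇.𝒦 Z t).G2 σ (𝔇.uOf Z t φ) - (𝔇.𝒦 Z t).Γ₀.map (algebraMap ℝ ℂ)) b j‖
        ≤ ι.θΓ * Real.exp (-(ι.kap * tdist1 𝔇.Nf ((𝔇.𝒦 Z t).locΛ b) ((𝔇.𝒦 Z t).locN j))))
    (hdC : ∀ φ ∈ V, ∀ σ : TPt P.d (domCount P M (k + 1)) → ℂ, (∀ j, σ j ∈ ι.Uσ) →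
      ∀ b b', ‖((𝔇.A Z t φ σ)⁻¹ - (𝔇.𝒦 Z t).C.map (algebraMap ℝ ℂ)) b b'‖
        ≤ ι.θC * Real.exp (-(ι.kap * tdist1 𝔇.Nf ((𝔇.𝒦 Z t).locΛ b) ((𝔇.𝒦 Z t).locΛ b'))))
    (hdE : ∀ φ ∈ V, ∀ σ : TPt P.d (domCount P M (k + 1)) → ℂ, (∀ j, σ j ∈ ι.Uσ) →
      ∀ b b', ‖(𝔇.A Z t φ σ - (𝔇.𝒦 Z t).C⁻¹.map (algebraMap ℝ ℂ)) b b'‖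
        ≤ ι.θE * Real.exp (-(ι.kap * tdist1 𝔇.Nf ((𝔇.𝒦 Z t).locΛ b) ((𝔇.𝒦 Z t).locΛ b')))) :
    DifferentiableOn ℂ (fun φ => 𝔇.TF Z t s old φ) V ∧
      ∀ φ ∈ V, ‖𝔇.TF Z t s old φ‖ ≤ weight L M c Z a t * Real.exp (a₅ * ((Z.1).card : ℝ)) :=
  hol_and_h226_torus_of_primitives_param c hκ₁ hα₆ Z t ι.hpos ι.hhalf ι.hUσ ι.hUτ ι.hUexp ι.hUtau ι.hr ι.hr' ι.hsubτ
    (sigmaList L Z t) (sigmaList_spec Z t) (tauList P M k L t) (tauList_spec t) hV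
    (fun φ => 𝔇.A Z t φ) (fun φ => 𝔇.Gam Z t φ) (fun φ σ => (𝔇.𝒦 Z t).G2 σ (𝔇.uOf Z t φ))
    (𝔇.chiY₀ Z t s) (𝔇.chicP Z t s) ι.hχ0 ι.hχc0 t.1 (fun φ => 𝔇.𝒱 Z t s old φ) (𝔇.𝒦 Z t).hC (𝔇.𝒦 Z t).Γ₀
    hAhol hGhol hAholφ hGholφ hVholφ ι.hχm ι.hχcm hVm hAs hA (fun _ _ _ _ _ => rfl)
    ι.qP ι.h222 ι.hγ₂ ι.hqP ι.ha0 h220U (𝔇.𝒦 Z t).locΛ (𝔇.𝒦 Z t).locN (𝔇.𝒦 Z t).hfib ι.hfibN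
    ι.hkap'' ι.h1 ι.h2 ι.hθE ι.hθΓ ι.hθC ι.hKG ι.hKΓ ι.hKCs ι.hK₀ ι.hθEle ι.hθΓle ι.hθR1le hG ι.hΓ₀ hCs ι.hC216 hdΓ hdC hdE ι.hsmallKθ
    ι.hc0 ι.hc ι.hαc ι.hg ι.hΓq ι.hsmall ι.hPa ι.hvol

/-- **★ THE TABLE-BASED EDITION**: at EVERY point `φ₁` of the open table `V` a record of located inputs whose eleven configuration-dependent fields hold, with
THAT record's letters, at every point of `V`, and the three joint-holomorphy letters on `V` for that record's σ-polydisc ⟹ (hol in `φ` on `V`) ∧ ((2.26) on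
`V`).  Vacuous on an empty table; a holder of records with COMMON letters along `V` (NODE A's uniform walk records ∘ the reading map, file 27) meets it with
one and the same proof at every `φ₁`.  Holomorphy at `φ₁`: the one-record edition based at `φ₁`; (2.26) at `φ₁`: W1's socket on the record at `φ₁`.
[cite: Balaban1988RG2Cluster, (2.14) p.15 and the analyticity statement p.15, (2.26) p.17] -/
theorem differentiableOn_and_norm_TF_of_inputs226Holo_on {c : B13.Consts} (hκ₁ : 1 ≤ c.κ₁) (hα₆ : c.α₆ ≠ 0)
    (Z : (domSys P M (k + 1)).Dom) (t : TermLabel P M k L) (s : ℂ) (old : OlderTerms P 𝔸 M k) {V : Set (CPair P 𝔸)} (hV : IsOpen V) {a a₅ : ℝ}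
    (hloc : ∀ φ₁ ∈ V, ∃ ι : 𝔇.Inputs226Holo c Z t s old φ₁ a a₅,
      (∀ φ ∈ V, ∀ i j, DifferentiableOn ℂ (fun σ => 𝔇.A Z t φ σ i j) {σ | ∀ j, σ j ∈ ι.Uσ}) ∧
      (∀ φ ∈ V, ∀ i j, DifferentiableOn ℂ (fun σ => (𝔇.𝒦 Z t).G2 σ (𝔇.uOf Z t φ) i j) {σ | ∀ j, σ j ∈ ι.Uσ}) ∧
      (∀ σ : TPt P.d (domCount P M (k + 1)) → ℂ, (∀ j, σ j ∈ ι.Uσ) → ∀ i j, DifferentiableOn ℂ (fun φ => 𝔇.A Z t φ σ i j) V) ∧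
      (∀ σ : TPt P.d (domCount P M (k + 1)) → ℂ, (∀ j, σ j ∈ ι.Uσ) → ∀ i j, DifferentiableOn ℂ (fun φ => (𝔇.𝒦 Z t).G2 σ (𝔇.uOf Z t φ) i j) V) ∧
      (∀ Y B, DifferentiableOn ℂ (fun φ => 𝔇.𝒱 Z t s old φ Y B) V) ∧
      (∀ φ ∈ V, ∀ Y, Measurable (𝔇.𝒱 Z t s old φ Y)) ∧
      (∀ φ ∈ V, ∀ σ : TPt P.d (domCount P M (k + 1)) → ℂ, (∀ j, σ j ∈ ι.Uσ) → (𝔇.A Z t φ σ).IsSymm) ∧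
      (∀ φ ∈ V, ∀ σ : TPt P.d (domCount P M (k + 1)) → ℂ, (∀ j, σ j ∈ ι.Uσ) → ((𝔇.A Z t φ σ).map Complex.re).PosDef) ∧
      (∀ φ ∈ V, ∀ τ : TDom P.d (L * domCount P M (k + 1)) → ℂ, (∀ Y, τ Y ∈ ι.Uτ Y) →
        ∀ B, ∑ Y ∈ t.1, ‖τ Y‖ * ‖𝔇.𝒱 Z t s old φ Y B‖ ≤ ι.a₂₀ / 2 * (B ⬝ᵥ B) + ι.w) ∧
      (∀ φ ∈ V, ∀ σ : TPt P.d (domCount P M (k + 1)) → ℂ, (∀ j, σ j ∈ ι.Uσ) →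
        ∀ b j, ‖(𝔇.𝒦 Z t).G2 σ (𝔇.uOf Z t φ) b j‖ ≤ ι.KG * Real.exp (-(ι.kap * tdist1 𝔇.Nf ((𝔇.𝒦 Z t).locΛ b) ((𝔇.𝒦 Z t).locN j)))) ∧
      (∀ φ ∈ V, ∀ σ : TPt P.d (domCount P M (k + 1)) → ℂ, (∀ j, σ j ∈ ι.Uσ) →
        ∀ b b', ‖(𝔇.A Z t φ σ)⁻¹ b b'‖ ≤ ι.KCs * Real.exp (-(ι.kap * tdist1 𝔇.Nf ((𝔇.𝒦 Z t).locΛ b) ((𝔇.𝒦 Z t).locΛ b')))) ∧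
      (∀ φ ∈ V, ∀ σ : TPt P.d (domCount P M (k + 1)) → ℂ, (∀ j, σ j ∈ ι.Uσ) →
        ∀ b j, ‖((𝔇.𝒦 Z t).G2 σ (𝔇.uOf Z t φ) - (𝔇.𝒦 Z t).Γ₀.map (algebraMap ℝ ℂ)) b j‖
          ≤ ι.θΓ * Real.exp (-(ι.kap * tdist1 𝔇.Nf ((𝔇.𝒦 Z t).locΛ b) ((𝔇.𝒦 Z t).locN j)))) ∧
      (∀ φ ∈ V, ∀ σ : TPt P.d (domCount P M (k + 1)) → ℂ, (∀ j, σ j ∈ ι.Uσ) →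
        ∀ b b', ‖((𝔇.A Z t φ σ)⁻¹ - (𝔇.𝒦 Z t).C.map (algebraMap ℝ ℂ)) b b'‖
          ≤ ι.θC * Real.exp (-(ι.kap * tdist1 𝔇.Nf ((𝔇.𝒦 Z t).locΛ b) ((𝔇.𝒦 Z t).locΛ b')))) ∧
      (∀ φ ∈ V, ∀ σ : TPt P.d (domCount P M (k + 1)) → ℂ, (∀ j, σ j ∈ ι.Uσ) →
        ∀ b b', ‖(𝔇.A Z t φ σ - (𝔇.𝒦 Z t).C⁻¹.map (algebraMap ℝ ℂ)) b b'‖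
          ≤ ι.θE * Real.exp (-(ι.kap * tdist1 𝔇.Nf ((𝔇.𝒦 Z t).locΛ b) ((𝔇.𝒦 Z t).locΛ b'))))) :
    DifferentiableOn ℂ (fun φ => 𝔇.TF Z t s old φ) V ∧
      ∀ φ ∈ V, ‖𝔇.TF Z t s old φ‖ ≤ weight L M c Z a t * Real.exp (a₅ * ((Z.1).card : ℝ)) := by
  refine ⟨fun φ₁ hφ₁ => ?_, fun φ₁ hφ₁ => ?_⟩
  · obtain ⟨ι, hAhol, hGhol, hAholφ, hGholφ, hVholφ, hVm, hAs, hA, h220U, hG, hCs, hdΓ, hdC, hdE⟩ := hloc φ₁ hφ₁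
    exact (differentiableOn_and_norm_TF_of_inputs226Holo_param 𝔇 hκ₁ hα₆ Z t s old hV ι hAhol hGhol hAholφ hGholφ hVholφ hVm hAs hA h220U hG hCs
      hdΓ hdC hdE).1 φ₁ hφ₁
  · obtain ⟨ι, -⟩ := hloc φ₁ hφ₁
    exact ι.norm_TF_le_weight hκ₁ hα₆

/-- **★ THE TWO CONSUMER CURRENCIES ON THE TABLE**: under the table-based records, `φ ↦ 𝔇.TF Z t s old φ` is ANALYTIC at every point of the open table `V`
(file 23's (T-an) binder type per term: Fréchet-holomorphic on an open set of the complex normed space `CPair P 𝔸` ⇒ analytic, [Chae1985] Thm 14.13) AND W1's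
propositional record `PrimitiveInputs226Holo` holds at every `φ ∈ V` (§1; whence (2.26) there by `norm_TF_le_weight_of_inputs226Holo` — file 25's (T-226)).
[cite: Balaban1988RG2Cluster, (2.14) p.15 and the analyticity statement p.15, (2.26) p.17; Chae1985, Thm 14.13] -/
theorem analyticOnNhd_and_primitiveInputs226Holo_of_inputs226Holo_on {c : B13.Consts} (hκ₁ : 1 ≤ c.κ₁) (hα₆ : c.α₆ ≠ 0)
    (Z : (domSys P M (k + 1)).Dom) (t : TermLabel P M k L) (s : ℂ) (old : OlderTerms P 𝔸 M k) {V : Set (CPair P 𝔸)} (hV : IsOpen V) {a a₅ : ℝ}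
    (hloc : ∀ φ₁ ∈ V, ∃ ι : 𝔇.Inputs226Holo c Z t s old φ₁ a a₅,
      (∀ φ ∈ V, ∀ i j, DifferentiableOn ℂ (fun σ => 𝔇.A Z t φ σ i j) {σ | ∀ j, σ j ∈ ι.Uσ}) ∧
      (∀ φ ∈ V, ∀ i j, DifferentiableOn ℂ (fun σ => (𝔇.𝒦 Z t).G2 σ (𝔇.uOf Z t φ) i j) {σ | ∀ j, σ j ∈ ι.Uσ}) ∧
      (∀ σ : TPt P.d (domCount P M (k + 1)) → ℂ, (∀ j, σ j ∈ ι.Uσ) → ∀ i j, DifferentiableOn ℂ (fun φ => 𝔇.A Z t φ σ i j) V) ∧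
      (∀ σ : TPt P.d (domCount P M (k + 1)) → ℂ, (∀ j, σ j ∈ ι.Uσ) → ∀ i j, DifferentiableOn ℂ (fun φ => (𝔇.𝒦 Z t).G2 σ (𝔇.uOf Z t φ) i j) V) ∧
      (∀ Y B, DifferentiableOn ℂ (fun φ => 𝔇.𝒱 Z t s old φ Y B) V) ∧
      (∀ φ ∈ V, ∀ Y, Measurable (𝔇.𝒱 Z t s old φ Y)) ∧
      (∀ φ ∈ V, ∀ σ : TPt P.d (domCount P M (k + 1)) → ℂ, (∀ j, σ j ∈ ι.Uσ) → (𝔇.A Z t φ σ).IsSymm) ∧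
      (∀ φ ∈ V, ∀ σ : TPt P.d (domCount P M (k + 1)) → ℂ, (∀ j, σ j ∈ ι.Uσ) → ((𝔇.A Z t φ σ).map Complex.re).PosDef) ∧
      (∀ φ ∈ V, ∀ τ : TDom P.d (L * domCount P M (k + 1)) → ℂ, (∀ Y, τ Y ∈ ι.Uτ Y) →
        ∀ B, ∑ Y ∈ t.1, ‖τ Y‖ * ‖𝔇.𝒱 Z t s old φ Y B‖ ≤ ι.a₂₀ / 2 * (B ⬝ᵥ B) + ι.w) ∧
      (∀ φ ∈ V, ∀ σ : TPt P.d (domCount P M (k + 1)) → ℂ, (∀ j, σ j ∈ ι.Uσ) →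
        ∀ b j, ‖(𝔇.𝒦 Z t).G2 σ (𝔇.uOf Z t φ) b j‖ ≤ ι.KG * Real.exp (-(ι.kap * tdist1 𝔇.Nf ((𝔇.𝒦 Z t).locΛ b) ((𝔇.𝒦 Z t).locN j)))) ∧
      (∀ φ ∈ V, ∀ σ : TPt P.d (domCount P M (k + 1)) → ℂ, (∀ j, σ j ∈ ι.Uσ) →
        ∀ b b', ‖(𝔇.A Z t φ σ)⁻¹ b b'‖ ≤ ι.KCs * Real.exp (-(ι.kap * tdist1 𝔇.Nf ((𝔇.𝒦 Z t).locΛ b) ((𝔇.𝒦 Z t).locΛ b')))) ∧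
      (∀ φ ∈ V, ∀ σ : TPt P.d (domCount P M (k + 1)) → ℂ, (∀ j, σ j ∈ ι.Uσ) →
        ∀ b j, ‖((𝔇.𝒦 Z t).G2 σ (𝔇.uOf Z t φ) - (𝔇.𝒦 Z t).Γ₀.map (algebraMap ℝ ℂ)) b j‖
          ≤ ι.θΓ * Real.exp (-(ι.kap * tdist1 𝔇.Nf ((𝔇.𝒦 Z t).locΛ b) ((𝔇.𝒦 Z t).locN j)))) ∧
      (∀ φ ∈ V, ∀ σ : TPt P.d (domCount P M (k + 1)) → ℂ, (∀ j, σ j ∈ ι.Uσ) →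
        ∀ b b', ‖((𝔇.A Z t φ σ)⁻¹ - (𝔇.𝒦 Z t).C.map (algebraMap ℝ ℂ)) b b'‖
          ≤ ι.θC * Real.exp (-(ι.kap * tdist1 𝔇.Nf ((𝔇.𝒦 Z t).locΛ b) ((𝔇.𝒦 Z t).locΛ b')))) ∧
      (∀ φ ∈ V, ∀ σ : TPt P.d (domCount P M (k + 1)) → ℂ, (∀ j, σ j ∈ ι.Uσ) →
        ∀ b b', ‖(𝔇.A Z t φ σ - (𝔇.𝒦 Z t).C⁻¹.map (algebraMap ℝ ℂ)) b b'‖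
          ≤ ι.θE * Real.exp (-(ι.kap * tdist1 𝔇.Nf ((𝔇.𝒦 Z t).locΛ b) ((𝔇.𝒦 Z t).locΛ b'))))) :
    AnalyticOnNhd ℂ (fun φ => 𝔇.TF Z t s old φ) V ∧ ∀ φ ∈ V, 𝔇.PrimitiveInputs226Holo c Z t s old φ a a₅ := by
  refine ⟨analyticOnNhd_of_differentiableOn (differentiableOn_and_norm_TF_of_inputs226Holo_on 𝔇 hκ₁ hα₆ Z t s old hV hloc).1 hV, fun φ hφ => ?_⟩
  obtain ⟨ι, -⟩ := hloc φ hφ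
  exact ⟨ι⟩

end OneTerm

/-! ## §3 A datum family along the history: (T-an) and (T-226) on the open located-inputs tables, keyed on the table-based records -/

section Located

variable (F : T4Family) (K : ℕ) {𝔸 : Type} [NormedRing 𝔸] [NormedAlgebra ℂ 𝔸] {M : ℕ} [NeZero M] (L : ℕ) [NeZero L]
  {c₀ c : B13.Consts} (𝔇 : TermData214 c₀ (F.P K) 𝔸 M L) (D : Set ℂ)
  (sp big : (j : ℕ) → (domSys (F.P K) M j).Dom → Set (CPair (F.P K) 𝔸)) {E₀ r₁ a a₅ : ℝ}

/-- **(T-an) ∧ (T-226) FOR `𝔇.TF` ALONG THE HISTORY ON THE OPEN LOCATED-INPUTS TABLES, KEYED ON THE TABLE-BASED RECORDS** (§2 at `V := big (k+1) Z`):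
for every step `k`, every coupling `s ∈ D`, every older-term table in the class «(1.18)`(E₀,r₁)` on the tables `sp j` + analytic there» (the guard of LEMMA 2's
fields of the record), every `Z ∈ 𝐃_{k+1}` and every term `(𝐃,P) ∈ terms L M Z`: if at every `φ₁ ∈ big (k+1) Z` there is a record
`(𝔇 k).Inputs226Holo c Z (𝐃,P) s old φ₁ a a₅` whose eleven configuration-dependent fields hold on all of `big (k+1) Z` together with the three joint-holomorphy
letters there, then `φ ↦ 𝔇.TF k Z (𝐃,P) s old φ` is `DifferentiableOn ℂ` on `big (k+1) Z` and (2.26) holds at every `φ ∈ big (k+1) Z`.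
[cite: Balaban1988RG2Cluster, (2.14) p.15 and the analyticity statement p.15, (2.26) p.17, (2.16)-(2.22) p.16, (1.41) p.11] -/
theorem holAnd226_TF_of_inputs226Holo (hbigo : ∀ (k : ℕ) (Z : (domSys (F.P K) M (k + 1)).Dom), IsOpen (big (k + 1) Z))
    (hκ₁ : 1 ≤ c.κ₁) (hα₆ : c.α₆ ≠ 0)
    (hloc : ∀ k : ℕ, ∀ s ∈ D, ∀ old : OlderTerms (F.P K) 𝔸 M k,
      (∀ (j : Fin (k + 1)) (Y : (domSys (F.P K) M j).Dom), ∀ ψ ∈ sp j Y,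
          ‖old j Y ψ‖ ≤ E₀ * Real.exp (-(r₁ * (domSys (F.P K) M j).dj Y))) →
      (∀ (j : Fin (k + 1)) (Y : (domSys (F.P K) M j).Dom), AnalyticOnNhd ℂ (old j Y) (sp j Y)) →
      ∀ (Z : (domSys (F.P K) M (k + 1)).Dom), ∀ t ∈ terms L M Z, ∀ φ₁ ∈ big (k + 1) Z, ∃ ι : (𝔇 k).Inputs226Holo c Z t s old φ₁ a a₅,
        (∀ φ ∈ big (k + 1) Z, ∀ i j, DifferentiableOn ℂ (fun σ => (𝔇 k).A Z t φ σ i j) {σ | ∀ j, σ j ∈ ι.Uσ}) ∧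
        (∀ φ ∈ big (k + 1) Z, ∀ i j, DifferentiableOn ℂ (fun σ => ((𝔇 k).𝒦 Z t).G2 σ ((𝔇 k).uOf Z t φ) i j) {σ | ∀ j, σ j ∈ ι.Uσ}) ∧
        (∀ σ : TPt (F.P K).d (domCount (F.P K) M (k + 1)) → ℂ, (∀ j, σ j ∈ ι.Uσ) →
          ∀ i j, DifferentiableOn ℂ (fun φ => (𝔇 k).A Z t φ σ i j) (big (k + 1) Z)) ∧
        (∀ σ : TPt (F.P K).d (domCount (F.P K) M (k + 1)) → ℂ, (∀ j, σ j ∈ ι.Uσ) →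
          ∀ i j, DifferentiableOn ℂ (fun φ => ((𝔇 k).𝒦 Z t).G2 σ ((𝔇 k).uOf Z t φ) i j) (big (k + 1) Z)) ∧
        (∀ Y B, DifferentiableOn ℂ (fun φ => (𝔇 k).𝒱 Z t s old φ Y B) (big (k + 1) Z)) ∧
        (∀ φ ∈ big (k + 1) Z, ∀ Y, Measurable ((𝔇 k).𝒱 Z t s old φ Y)) ∧
        (∀ φ ∈ big (k + 1) Z, ∀ σ : TPt (F.P K).d (domCount (F.P K) M (k + 1)) → ℂ, (∀ j, σ j ∈ ι.Uσ) → ((𝔇 k).A Z t φ σ).IsSymm) ∧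
        (∀ φ ∈ big (k + 1) Z, ∀ σ : TPt (F.P K).d (domCount (F.P K) M (k + 1)) → ℂ, (∀ j, σ j ∈ ι.Uσ) →
          (((𝔇 k).A Z t φ σ).map Complex.re).PosDef) ∧
        (∀ φ ∈ big (k + 1) Z, ∀ τ : TDom (F.P K).d (L * domCount (F.P K) M (k + 1)) → ℂ, (∀ Y, τ Y ∈ ι.Uτ Y) →
          ∀ B, ∑ Y ∈ t.1, ‖τ Y‖ * ‖(𝔇 k).𝒱 Z t s old φ Y B‖ ≤ ι.a₂₀ / 2 * (B ⬝ᵥ B) + ι.w) ∧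
        (∀ φ ∈ big (k + 1) Z, ∀ σ : TPt (F.P K).d (domCount (F.P K) M (k + 1)) → ℂ, (∀ j, σ j ∈ ι.Uσ) →
          ∀ b j, ‖((𝔇 k).𝒦 Z t).G2 σ ((𝔇 k).uOf Z t φ) b j‖ ≤
            ι.KG * Real.exp (-(ι.kap * tdist1 (𝔇 k).Nf (((𝔇 k).𝒦 Z t).locΛ b) (((𝔇 k).𝒦 Z t).locN j)))) ∧
        (∀ φ ∈ big (k + 1) Z, ∀ σ : TPt (F.P K).d (domCount (F.P K) M (k + 1)) → ℂ, (∀ j, σ j ∈ ι.Uσ) →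
          ∀ b b', ‖((𝔇 k).A Z t φ σ)⁻¹ b b'‖ ≤
            ι.KCs * Real.exp (-(ι.kap * tdist1 (𝔇 k).Nf (((𝔇 k).𝒦 Z t).locΛ b) (((𝔇 k).𝒦 Z t).locΛ b')))) ∧
        (∀ φ ∈ big (k + 1) Z, ∀ σ : TPt (F.P K).d (domCount (F.P K) M (k + 1)) → ℂ, (∀ j, σ j ∈ ι.Uσ) →
          ∀ b j, ‖(((𝔇 k).𝒦 Z t).G2 σ ((𝔇 k).uOf Z t φ) - ((𝔇 k).𝒦 Z t).Γ₀.map (algebraMap ℝ ℂ)) b j‖ ≤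
            ι.θΓ * Real.exp (-(ι.kap * tdist1 (𝔇 k).Nf (((𝔇 k).𝒦 Z t).locΛ b) (((𝔇 k).𝒦 Z t).locN j)))) ∧
        (∀ φ ∈ big (k + 1) Z, ∀ σ : TPt (F.P K).d (domCount (F.P K) M (k + 1)) → ℂ, (∀ j, σ j ∈ ι.Uσ) →
          ∀ b b', ‖(((𝔇 k).A Z t φ σ)⁻¹ - ((𝔇 k).𝒦 Z t).C.map (algebraMap ℝ ℂ)) b b'‖ ≤
            ι.θC * Real.exp (-(ι.kap * tdist1 (𝔇 k).Nf (((𝔇 k).𝒦 Z t).locΛ b) (((𝔇 k).𝒦 Z t).locΛ b')))) ∧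
        (∀ φ ∈ big (k + 1) Z, ∀ σ : TPt (F.P K).d (domCount (F.P K) M (k + 1)) → ℂ, (∀ j, σ j ∈ ι.Uσ) →
          ∀ b b', ‖((𝔇 k).A Z t φ σ - ((𝔇 k).𝒦 Z t).C⁻¹.map (algebraMap ℝ ℂ)) b b'‖ ≤
            ι.θE * Real.exp (-(ι.kap * tdist1 (𝔇 k).Nf (((𝔇 k).𝒦 Z t).locΛ b) (((𝔇 k).𝒦 Z t).locΛ b'))))) :
    ∀ k : ℕ, ∀ s ∈ D, ∀ old : OlderTerms (F.P K) 𝔸 M k,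
      (∀ (j : Fin (k + 1)) (Y : (domSys (F.P K) M j).Dom), ∀ ψ ∈ sp j Y,
          ‖old j Y ψ‖ ≤ E₀ * Real.exp (-(r₁ * (domSys (F.P K) M j).dj Y))) →
      (∀ (j : Fin (k + 1)) (Y : (domSys (F.P K) M j).Dom), AnalyticOnNhd ℂ (old j Y) (sp j Y)) →
      ∀ (Z : (domSys (F.P K) M (k + 1)).Dom), ∀ t ∈ terms L M Z,
        DifferentiableOn ℂ (fun φ => 𝔇.TF k Z t s old φ) (big (k + 1) Z) ∧
          ∀ φ ∈ big (k + 1) Z, ‖𝔇.TF k Z t s old φ‖ ≤ weight L M c Z a t * Real.exp (a₅ * ((Z.1).card : ℝ)) := by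
  intro k s hs old hB hAn Z t ht
  rw [TermData214.TF_apply]
  exact differentiableOn_and_norm_TF_of_inputs226Holo_on (𝔇 k) hκ₁ hα₆ Z t s old (hbigo k Z) (hloc k s hs old hB hAn Z t ht)

/-- **★★ (T-an) FOR `𝔇.TF` ALONG THE HISTORY — file 23's `hTan` BINDER, FROM THE TABLE-BASED RECORDS** on every table family `sp₁` inside the open
located-inputs tables (`sp₁ (k+1) Z ⊆ big (k+1) Z`; file 23: `sp₁ := sp`, file 24's pair: `sp₁ := sp′`): for every step, coupling `s ∈ D`, older-term table
in the guard class, `Z` and term, `φ ↦ 𝔇.TF k Z (𝐃,P) s old φ` is ANALYTIC at the points of `sp₁ (k+1) Z` — print's «analytic function of (𝐔, 𝐉)» ([II] p. 15)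
read off W1's records of located inputs (holomorphy under the integral at the corner values + [Chae1985] Thm 14.13).
[cite: Balaban1988RG2Cluster, (2.14) p.15 and the analyticity statement p.15; Chae1985, Thm 14.13] -/
theorem termwiseAn_TF_of_inputs226Holo (hbigo : ∀ (k : ℕ) (Z : (domSys (F.P K) M (k + 1)).Dom), IsOpen (big (k + 1) Z))
    (hκ₁ : 1 ≤ c.κ₁) (hα₆ : c.α₆ ≠ 0)
    (hloc : ∀ k : ℕ, ∀ s ∈ D, ∀ old : OlderTerms (F.P K) 𝔸 M k,
      (∀ (j : Fin (k + 1)) (Y : (domSys (F.P K) M j).Dom), ∀ ψ ∈ sp j Y,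
          ‖old j Y ψ‖ ≤ E₀ * Real.exp (-(r₁ * (domSys (F.P K) M j).dj Y))) →
      (∀ (j : Fin (k + 1)) (Y : (domSys (F.P K) M j).Dom), AnalyticOnNhd ℂ (old j Y) (sp j Y)) →
      ∀ (Z : (domSys (F.P K) M (k + 1)).Dom), ∀ t ∈ terms L M Z, ∀ φ₁ ∈ big (k + 1) Z, ∃ ι : (𝔇 k).Inputs226Holo c Z t s old φ₁ a a₅,
        (∀ φ ∈ big (k + 1) Z, ∀ i j, DifferentiableOn ℂ (fun σ => (𝔇 k).A Z t φ σ i j) {σ | ∀ j, σ j ∈ ι.Uσ}) ∧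
        (∀ φ ∈ big (k + 1) Z, ∀ i j, DifferentiableOn ℂ (fun σ => ((𝔇 k).𝒦 Z t).G2 σ ((𝔇 k).uOf Z t φ) i j) {σ | ∀ j, σ j ∈ ι.Uσ}) ∧
        (∀ σ : TPt (F.P K).d (domCount (F.P K) M (k + 1)) → ℂ, (∀ j, σ j ∈ ι.Uσ) →
          ∀ i j, DifferentiableOn ℂ (fun φ => (𝔇 k).A Z t φ σ i j) (big (k + 1) Z)) ∧
        (∀ σ : TPt (F.P K).d (domCount (F.P K) M (k + 1)) → ℂ, (∀ j, σ j ∈ ι.Uσ) →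
          ∀ i j, DifferentiableOn ℂ (fun φ => ((𝔇 k).𝒦 Z t).G2 σ ((𝔇 k).uOf Z t φ) i j) (big (k + 1) Z)) ∧
        (∀ Y B, DifferentiableOn ℂ (fun φ => (𝔇 k).𝒱 Z t s old φ Y B) (big (k + 1) Z)) ∧
        (∀ φ ∈ big (k + 1) Z, ∀ Y, Measurable ((𝔇 k).𝒱 Z t s old φ Y)) ∧
        (∀ φ ∈ big (k + 1) Z, ∀ σ : TPt (F.P K).d (domCount (F.P K) M (k + 1)) → ℂ, (∀ j, σ j ∈ ι.Uσ) → ((𝔇 k).A Z t φ σ).IsSymm) ∧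
        (∀ φ ∈ big (k + 1) Z, ∀ σ : TPt (F.P K).d (domCount (F.P K) M (k + 1)) → ℂ, (∀ j, σ j ∈ ι.Uσ) →
          (((𝔇 k).A Z t φ σ).map Complex.re).PosDef) ∧
        (∀ φ ∈ big (k + 1) Z, ∀ τ : TDom (F.P K).d (L * domCount (F.P K) M (k + 1)) → ℂ, (∀ Y, τ Y ∈ ι.Uτ Y) →
          ∀ B, ∑ Y ∈ t.1, ‖τ Y‖ * ‖(𝔇 k).𝒱 Z t s old φ Y B‖ ≤ ι.a₂₀ / 2 * (B ⬝ᵥ B) + ι.w) ∧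
        (∀ φ ∈ big (k + 1) Z, ∀ σ : TPt (F.P K).d (domCount (F.P K) M (k + 1)) → ℂ, (∀ j, σ j ∈ ι.Uσ) →
          ∀ b j, ‖((𝔇 k).𝒦 Z t).G2 σ ((𝔇 k).uOf Z t φ) b j‖ ≤
            ι.KG * Real.exp (-(ι.kap * tdist1 (𝔇 k).Nf (((𝔇 k).𝒦 Z t).locΛ b) (((𝔇 k).𝒦 Z t).locN j)))) ∧
        (∀ φ ∈ big (k + 1) Z, ∀ σ : TPt (F.P K).d (domCount (F.P K) M (k + 1)) → ℂ, (∀ j, σ j ∈ ι.Uσ) →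
          ∀ b b', ‖((𝔇 k).A Z t φ σ)⁻¹ b b'‖ ≤
            ι.KCs * Real.exp (-(ι.kap * tdist1 (𝔇 k).Nf (((𝔇 k).𝒦 Z t).locΛ b) (((𝔇 k).𝒦 Z t).locΛ b')))) ∧
        (∀ φ ∈ big (k + 1) Z, ∀ σ : TPt (F.P K).d (domCount (F.P K) M (k + 1)) → ℂ, (∀ j, σ j ∈ ι.Uσ) →
          ∀ b j, ‖(((𝔇 k).𝒦 Z t).G2 σ ((𝔇 k).uOf Z t φ) - ((𝔇 k).𝒦 Z t).Γ₀.map (algebraMap ℝ ℂ)) b j‖ ≤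
            ι.θΓ * Real.exp (-(ι.kap * tdist1 (𝔇 k).Nf (((𝔇 k).𝒦 Z t).locΛ b) (((𝔇 k).𝒦 Z t).locN j)))) ∧
        (∀ φ ∈ big (k + 1) Z, ∀ σ : TPt (F.P K).d (domCount (F.P K) M (k + 1)) → ℂ, (∀ j, σ j ∈ ι.Uσ) →
          ∀ b b', ‖(((𝔇 k).A Z t φ σ)⁻¹ - ((𝔇 k).𝒦 Z t).C.map (algebraMap ℝ ℂ)) b b'‖ ≤
            ι.θC * Real.exp (-(ι.kap * tdist1 (𝔇 k).Nf (((𝔇 k).𝒦 Z t).locΛ b) (((𝔇 k).𝒦 Z t).locΛ b')))) ∧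
        (∀ φ ∈ big (k + 1) Z, ∀ σ : TPt (F.P K).d (domCount (F.P K) M (k + 1)) → ℂ, (∀ j, σ j ∈ ι.Uσ) →
          ∀ b b', ‖((𝔇 k).A Z t φ σ - ((𝔇 k).𝒦 Z t).C⁻¹.map (algebraMap ℝ ℂ)) b b'‖ ≤
            ι.θE * Real.exp (-(ι.kap * tdist1 (𝔇 k).Nf (((𝔇 k).𝒦 Z t).locΛ b) (((𝔇 k).𝒦 Z t).locΛ b')))))
    (sp₁ : (j : ℕ) → (domSys (F.P K) M j).Dom → Set (CPair (F.P K) 𝔸))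
    (hsub : ∀ (k : ℕ) (Z : (domSys (F.P K) M (k + 1)).Dom), sp₁ (k + 1) Z ⊆ big (k + 1) Z) :
    ∀ k : ℕ, ∀ s ∈ D, ∀ old : OlderTerms (F.P K) 𝔸 M k,
      (∀ (j : Fin (k + 1)) (Y : (domSys (F.P K) M j).Dom), ∀ ψ ∈ sp j Y,
          ‖old j Y ψ‖ ≤ E₀ * Real.exp (-(r₁ * (domSys (F.P K) M j).dj Y))) →
      (∀ (j : Fin (k + 1)) (Y : (domSys (F.P K) M j).Dom), AnalyticOnNhd ℂ (old j Y) (sp j Y)) →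
      ∀ (Z : (domSys (F.P K) M (k + 1)).Dom), ∀ t ∈ terms L M Z, AnalyticOnNhd ℂ (fun φ => (𝔇 k).TF Z t s old φ) (sp₁ (k + 1) Z) := by
  intro k s hs old hB hAn Z t ht
  exact ((analyticOnNhd_and_primitiveInputs226Holo_of_inputs226Holo_on (𝔇 k) hκ₁ hα₆ Z t s old (hbigo k Z)
    (hloc k s hs old hB hAn Z t ht)).1).mono (hsub k Z)

end Located

end Summit.QuantumFields.YangMills.BalabanUVNodes.N18HLayerW1TermInputs226

end
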